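import Mathlib
import Summits.Ventures.HodgeRepro.Tier4.Common.AdelicRTF
import Summits.Ventures.HodgeRepro.Tier4.Common.AdelicHaar
import Summits.Ventures.HodgeRepro.Tier4.Common.DiscreteImage
import Summits.Ventures.HodgeRepro.Tier4.Common.MixedPlaneCusp
import Summits.Ventures.HodgeRepro.Tier4.Line4.GeometricSide
import Summits.Ventures.HodgeRepro.Tier4.Line4.OrbitalUnfold
import Summits.Ventures.HodgeRepro.Tier4.Line1.RationalPoints
import Summits.Ventures.HodgeRepro.Tier4.Line1.LocallyCompactGA
import Summits.Ventures.HodgeRepro.Tier4.Line1.SecondCountableGA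

/-!
# Tier4/Line4/IntegFolded — C-L4-INTEG, module 1 of 2: the integrability / summability displays of the FOLDED
orbital integrals ((A1)–(A4), (B0), (B4) of t4-plan-4 g3's Part 8, and (B2)) from `Continuous F ∧ HasCompactSupport F`

Blind re-derivation cell `pub-hodge-repro`, Tier 4 (README §9–§10), seat t4-L1-p5 (prover, gen 4; seat of record
LINE L1, working LINE L4's cut C-L4-INTEG named by t4-plan-4 g3 S14649 / S14681, taken S14685).  Target tree path
`lean/Summits/Ventures/HodgeRepro/Tier4/Line4/IntegFolded.lean`.  Statements VERBATIM from HOME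
proofs/t4-plan-4/work/Integ-Concat-v2.lean (efc313b641e3a2f3 · 671) L493–L548, with crit-1 g7's audit (S14664:
«all 13 true as stated, none vacuous») — the only edit is the `_`-prefix on the binders a proof does not touch (the
gate's `unusedVariables` lint bounces a named idle hypothesis; the Props are unchanged, the positions are kept, the
consumer `horb_of_integ` is unaffected).

WHAT IS PROVED (Mathlib only beyond the tree's definitions; no printed input).
* `finite_rationalPoints_inter_isCompact` — `G(k)` meets every compact set of `G(𝔸_k)` in a finite set (DiscreteImage's
  `finite_inter_of_discrete_of_isCompact` with `rationalPoints_discrete` and `t2Space_GA`).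
* `finite_rational_conj` — THE FINITE-SUPPORT LEMMA shared by (A2)/(A4)/(B0)/(B4): for compact `Kt`, `Kt'`, `C` and
  any `g₀`, the rational `g` with `t⁻¹ (g₀ g) t' ∈ C` for some `t ∈ Kt`, `t' ∈ Kt'` form a finite set — they lie in the
  compact `{g₀⁻¹} · Kt · C · Kt'⁻¹`.  `exists_finset_orbit` / `exists_finset_rationalOf'` pull it back to the index
  types of the sums (the orbit `Set.range (orbitMap W γ₀)` ⊆ `G(k)`; the rational points `T′(k)` of the torus).
* `periodLin_eq_zero_of_forall_eq_zero` / `orbitalc_eq_zero_of_forall` — the linear period of a function vanishing on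
  the fundamental domain is `0` (the function is integrable there, the linear functional is the integral, the
  integral of `0` is `0`); so a folded orbital integral vanishes when `F(t⁻¹ γ t′) = 0` on `D_T × D_{T′}`.
* (B2) `integrable_innerFn_full` — over ALL of `T′(𝔸)`: the inner integrand `t′ ↦ conj χ′(t′) F(s⁻¹ γ₀ t′)` is
  continuous with compact support (`torusT'` is closed in `G(𝔸_k)`, AdelicHaar `isClosed_torusT'`, so the preimage
  of the compact `(s⁻¹ γ₀)⁻¹ · tsupport F` is compact), hence integrable for the Haar measure `μ_{T′}`; (A1)
  `integrable_innerFn_restrict` is its restriction to `D_{T′}`.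
* (A3) `integrable_chi_mul_innerInt_restrict` — `t ↦ χ(t) I_γ(t)` is CONTINUOUS on `T(𝔸)` (dominated convergence,
  `continuous_of_dominated`, with the constant bound `‖F‖_∞` on the finite measure `μ_{T′}|_{D_{T′}}`) and bounded by
  `‖F‖_∞ · μ_{T′}(D_{T′})`, hence integrable on the finite measure `μ_T|_{D_T}`.
* (A2) `summable_integral_norm_innerFn_orbit`, (A4) `summable_integral_norm_chi_mul_innerInt_orbit`,
  (B0) `summable_orbitalc_orbit`, (B4) `summable_integral_norm_chi_mul_innerInt_rational` — finite support: outside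
  the finite set of the lemma the integrand vanishes on the domains, so the summand is `0`
  (`summable_of_ne_finset_zero`).

Module 2 (`Tier4/Line4/IntegProper.lean`: (B1), (C), (D) on PROPER + ZDOMAIN-EX (iv)) follows when OrbitProper and
CentreFinDomain serve.  Nothing here says anything about the status of the Hodge conjecture for CM abelian
varieties, which is NOT proved (HC_CM is NOT proved by anyone in this repository).
-/

set_option autoImplicit false

noncomputable section

namespace Summit.Ventures.HodgeRepro.Tier4.Line4

open Summit.Ventures.HodgeRepro.Tier4.Common Summit.Ventures.HodgeRepro.Tier4.Line1 MeasureTheory NumberField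
  Topology Set

open scoped Pointwise

section FiniteSupport

variable {k : Type} [Field k] [NumberField k] (W : PlaneData k)

/-- **`G(k)` meets every compact set of `G(𝔸_k)` in a finite set**: the rational points are a discrete subgroup
(`rationalPoints_discrete`) of the Hausdorff group `G(𝔸_k)` (`t2Space_GA`); DiscreteImage
`finite_inter_of_discrete_of_isCompact`. -/
theorem finite_rationalPoints_inter_isCompact {L : Set (GA W)} (hL : IsCompact L) :
    ((rationalPoints W : Set (GA W)) ∩ L).Finite := by
  haveI := t2Space_GA W
  haveI := rationalPoints_discrete W
  exact finite_inter_of_discrete_of_isCompact (rationalPoints W) hL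

/-- **THE FINITE-SUPPORT LEMMA**: for compact `Kt`, `Kt'`, `C ⊆ G(𝔸_k)` and any `g₀`, the rational `g` with
`t⁻¹ (g₀ g) t' ∈ C` for some `t ∈ Kt`, `t' ∈ Kt'` form a finite set — each such `g = g₀⁻¹ t (t⁻¹ g₀ g t') t'⁻¹` lies
in the compact `{g₀⁻¹} · Kt · C · Kt'⁻¹`. -/
theorem finite_rational_conj (g₀ : GA W) {Kt Kt' : Set (GA W)} (hKt : IsCompact Kt) (hKt' : IsCompact Kt')
    {C : Set (GA W)} (hC : IsCompact C) :
    {g : GA W | g ∈ rationalPoints W ∧ ∃ t ∈ Kt, ∃ t' ∈ Kt', t⁻¹ * (g₀ * g) * t' ∈ C}.Finite := by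
  have hL : IsCompact ((({g₀⁻¹} * Kt) * C) * Kt'⁻¹) := ((isCompact_singleton.mul hKt).mul hC).mul hKt'.inv
  refine (finite_rationalPoints_inter_isCompact W hL).subset ?_
  rintro g ⟨hg, t, ht, t', ht', hc⟩
  refine ⟨hg, ?_⟩
  have hgeq : g = ((g₀⁻¹ * t) * (t⁻¹ * (g₀ * g) * t')) * t'⁻¹ := by group
  rw [hgeq]
  exact Set.mul_mem_mul (Set.mul_mem_mul (Set.mul_mem_mul (Set.mem_singleton _) ht) hc) (Set.inv_mem_inv.2 ht')

/-- the finite-support lemma on the ORBIT `{δ⁻¹ γ₀ δ′} ⊆ G(k)` of `γ₀`: outside a finite set of orbit points,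
`F(t⁻¹ γ t′) = 0` for every `t ∈ Kt`, `t′ ∈ Kt'`. -/
theorem exists_finset_orbit (γ₀ : rationalPoints W) {Kt Kt' : Set (GA W)} (hKt : IsCompact Kt)
    (hKt' : IsCompact Kt') (F : GA W → ℂ) (hFs : HasCompactSupport F) :
    ∃ s : Finset (Set.range (orbitMap W γ₀)), ∀ γ ∉ s, ∀ t ∈ Kt, ∀ t' ∈ Kt',
      F (t⁻¹ * ((γ : rationalPoints W) : GA W) * t') = 0 := by
  have hfin := finite_rational_conj W 1 hKt hKt' hFs.isCompact
  have hfin' : {γ : Set.range (orbitMap W γ₀) | ((γ : rationalPoints W) : GA W) ∈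
      {g : GA W | g ∈ rationalPoints W ∧ ∃ t ∈ Kt, ∃ t' ∈ Kt', t⁻¹ * (1 * g) * t' ∈ tsupport F}}.Finite :=
    hfin.preimage (Function.Injective.injOn (Subtype.val_injective.comp Subtype.val_injective))
  refine ⟨hfin'.toFinset, fun γ hγ t ht t' ht' => ?_⟩
  rw [Set.Finite.mem_toFinset] at hγ
  apply image_eq_zero_of_notMem_tsupport
  intro hmem
  exact hγ ⟨(γ : rationalPoints W).2, t, ht, t', ht', by simpa using hmem⟩

/-- the finite-support lemma on the rational points `T′(k)` of the torus, twisted by `g₀` (for (B4), with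
`g₀ = δ⁻¹ γ₀`): outside a finite set of `δ′ ∈ T′(k)`, `F(t⁻¹ (g₀ δ′) t′) = 0` for every `t ∈ Kt`, `t′ ∈ Kt'`. -/
theorem exists_finset_rationalOf' (g₀ : GA W) {Kt Kt' : Set (GA W)} (hKt : IsCompact Kt)
    (hKt' : IsCompact Kt') (F : GA W → ℂ) (hFs : HasCompactSupport F) :
    ∃ s : Finset (rationalOf W (torusT' W)), ∀ δ' ∉ s, ∀ t ∈ Kt, ∀ t' ∈ Kt',
      F (t⁻¹ * (g₀ * ((δ' : torusT' W) : GA W)) * t') = 0 := by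
  have hfin := finite_rational_conj W g₀ hKt hKt' hFs.isCompact
  have hfin' : {δ' : rationalOf W (torusT' W) | ((δ' : torusT' W) : GA W) ∈
      {g : GA W | g ∈ rationalPoints W ∧ ∃ t ∈ Kt, ∃ t' ∈ Kt', t⁻¹ * (g₀ * g) * t' ∈ tsupport F}}.Finite :=
    hfin.preimage (Function.Injective.injOn (Subtype.val_injective.comp Subtype.val_injective))
  refine ⟨hfin'.toFinset, fun δ' hδ' t ht t' ht' => ?_⟩
  rw [Set.Finite.mem_toFinset] at hδ'
  apply image_eq_zero_of_notMem_tsupport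
  intro hmem
  exact hδ' ⟨Subgroup.mem_subgroupOf.1 δ'.2, t, ht, t', ht', hmem⟩

end FiniteSupport

section Vanishing

variable {k : Type} [Field k] [NumberField k] (W : PlaneData k)

/-- **the linear period of a function vanishing on the domain is `0`**: `χ · G` vanishes on `D`, hence is integrable
for `μ_S|_D` (`D` null-measurable), so the linear period IS the integral (`periodLin_eq_integral`), and the integral of
a function vanishing on `D` is `0`. -/
theorem periodLin_eq_zero_of_forall_eq_zero {S : Subgroup (GA W)} [MeasurableSpace S] (μS : Measure S) {D : Set S}
    (hD : NullMeasurableSet D μS) (χ : S → ℂ) {G : S → ℂ} (hG : ∀ t ∈ D, G t = 0) :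
    periodLin W μS D χ G = 0 := by
  have hint : Integrable (fun t => χ t * G t) (μS.restrict D) := by
    refine (integrable_zero _ _ _).congr ?_
    refine (ae_restrict_iff'₀ hD).2 (ae_of_all _ fun t ht => ?_)
    simp [hG t ht]
  rw [periodLin_eq_integral W μS D χ hint]
  exact setIntegral_eq_zero_of_forall_eq_zero fun t ht => by simp [hG t ht]

variable [MeasurableSpace (GA W)] [BorelSpace (GA W)] (R : RTFData W)

omit [BorelSpace (GA W)] in
/-- **a folded orbital integral vanishes when `F(t⁻¹ γ t′) = 0` on `D_T × D_{T′}`**: the inner linear period is `0`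
for every `t ∈ D_T`, hence so is the outer one. -/
theorem orbitalc_eq_zero_of_forall (F : GA W → ℂ) (γ : GA W)
    (h : ∀ t ∈ R.DT, ∀ t' ∈ R.DT', F ((t : GA W)⁻¹ * γ * (t' : GA W)) = 0) : R.orbitalc γ F = 0 := by
  unfold RTFData.orbitalc RTFData.periodT RTFData.periodT'conj
  refine periodLin_eq_zero_of_forall_eq_zero W R.μT R.DT_fund.nullMeasurableSet R.chi fun t ht => ?_
  exact periodLin_eq_zero_of_forall_eq_zero W R.μT' R.DT'_fund.nullMeasurableSet R.chi'conj
    fun t' ht' => h t ht t' ht'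

omit [BorelSpace (GA W)] in
/-- the inner integral vanishes when the integrand does on `D_{T′}`. -/
theorem innerInt_eq_zero_of_forall (F : GA W → ℂ) (γ : GA W) (t : torusT W)
    (h : ∀ t' ∈ R.DT', F ((t : GA W)⁻¹ * γ * (t' : GA W)) = 0) : innerInt W R F γ t = 0 := by
  unfold innerInt
  exact setIntegral_eq_zero_of_forall_eq_zero fun t' ht' => by simp [innerFn, h t' ht']

end Vanishing

section Integ

variable {k : Type} [Field k] [NumberField k] (W : PlaneData k) [MeasurableSpace (GA W)] [BorelSpace (GA W)]
  (R : RTFData W)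

/-- (B2) over ALL of `T′(𝔸)`: for fixed `s` the `t′`-support of `t′ ↦ F(s⁻¹ γ₀ t′)` is
`T′ ∩ (γ₀⁻¹ s · tsupport F)`, compact because `torusT'` is closed in `G(𝔸)` (crit-1 S14664: no PROPER, no
`CompactSpace (torusInf' W)` needed). -/
theorem integrable_innerFn_full (hR : R.IsHaar) (hc' : Continuous R.chi')
    (_hu' : ∀ a, ‖R.chi' a‖ = 1) (F : GA W → ℂ) (hFc : Continuous F) (hFs : HasCompactSupport F)
    (γ₀ : GA W) (s : torusT W) :
    Integrable (innerFn W R F γ₀ s) R.μT' := by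
  haveI : R.μT'.IsHaarMeasure := hR.2.1
  have hcont : Continuous (innerFn W R F γ₀ s) := by
    unfold innerFn RTFData.chi'conj
    exact (Complex.continuous_conj.comp hc').mul (hFc.comp (continuous_const.mul continuous_subtype_val))
  have hsupp : HasCompactSupport (innerFn W R F γ₀ s) := by
    have h1 : HasCompactSupport (fun x : GA W => F ((s : GA W)⁻¹ * γ₀ * x)) :=
      hFs.comp_homeomorph (Homeomorph.mulLeft ((s : GA W)⁻¹ * γ₀))
    have h2 : HasCompactSupport (fun t' : torusT' W => F ((s : GA W)⁻¹ * γ₀ * (t' : GA W))) :=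
      h1.comp_isClosedEmbedding (isClosed_torusT' W).isClosedEmbedding_subtypeVal
    exact h2.mul_left
  exact hcont.integrable_of_hasCompactSupport hsupp

/-- (A1) the inner integrand is integrable on `D_{T′}` (bounded, `μ_{T′}(D_{T′}) < ∞`). -/
theorem integrable_innerFn_restrict (hR : R.IsHaar) (hc' : Continuous R.chi') (_hu' : ∀ a, ‖R.chi' a‖ = 1)
    (F : GA W → ℂ) (hFc : Continuous F) (hFs : HasCompactSupport F) (γ : GA W) (t : torusT W) :
    Integrable (innerFn W R F γ t) (R.μT'.restrict R.DT') :=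
  (integrable_innerFn_full W R hR hc' _hu' F hFc hFs γ t).restrict

omit [BorelSpace (GA W)] in
/-- (A2) for fixed `t` only finitely many orbit points meet `t · supp F · (closure D_{T′})⁻¹` (`rationalPoints_closed` +
`rationalPoints_discrete` on a compact set), so the orbit sum of the inner `L¹`-norms is summable. -/
theorem summable_integral_norm_innerFn_orbit (_hR : R.IsHaar) (_hc' : Continuous R.chi') (_hu' : ∀ a, ‖R.chi' a‖ = 1)
    (compT' : IsCompact (closure R.DT')) (F : GA W → ℂ) (_hFc : Continuous F) (hFs : HasCompactSupport F)
    (γ₀ : rationalPoints W) (t : torusT W) :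
    Summable (fun γ : Set.range (orbitMap W γ₀) =>
      ∫ t' in R.DT', ‖innerFn W R F ((γ : rationalPoints W) : GA W) t t'‖ ∂(R.μT')) := by
  obtain ⟨s, hs⟩ := exists_finset_orbit W γ₀ (Kt := {(t : GA W)}) isCompact_singleton
    (compT'.image continuous_subtype_val) F hFs
  refine summable_of_ne_finset_zero (s := s) fun γ hγ => ?_
  refine setIntegral_eq_zero_of_forall_eq_zero fun t' ht' => ?_
  have h0 := hs γ hγ (t : GA W) (Set.mem_singleton _) (t' : GA W) ⟨t', subset_closure ht', rfl⟩
  simp [innerFn, h0]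

/-- (A3) `t ↦ χ(t) I_γ(t)` is integrable on `D_T` (bounded by `‖F‖_∞ μ_{T′}(D_{T′})`, measurable by Fubini). -/
theorem integrable_chi_mul_innerInt_restrict (hR : R.IsHaar) (hc : Continuous R.chi) (hu : ∀ a, ‖R.chi a‖ = 1)
    (hc' : Continuous R.chi') (hu' : ∀ a, ‖R.chi' a‖ = 1)
    (F : GA W → ℂ) (hFc : Continuous F) (hFs : HasCompactSupport F) (γ : GA W) :
    Integrable (fun t : torusT W => R.chi t * innerInt W R F γ t) (R.μT.restrict R.DT) := by
  obtain ⟨C, hC⟩ := hFc.bounded_above_of_compact_support hFs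
  haveI : SecondCountableTopology (GA W) := secondCountable_GA W
  haveI : SecondCountableTopology (torusT W) := TopologicalSpace.Subtype.secondCountableTopology (torusT W : Set (GA W))
  haveI : IsFiniteMeasure (R.μT'.restrict R.DT') := isFiniteMeasure_restrict.2 hR.2.2.2.2.2.ne
  haveI : IsFiniteMeasure (R.μT.restrict R.DT) := isFiniteMeasure_restrict.2 hR.2.2.2.1.ne
  have hbound : ∀ (t : torusT W) (t' : torusT' W), ‖innerFn W R F γ t t'‖ ≤ C := by
    intro t t'
    simp only [innerFn, RTFData.chi'conj, norm_mul, Complex.norm_conj, hu', one_mul]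
    exact hC _
  have hcontI : Continuous fun t : torusT W => innerInt W R F γ t := by
    unfold innerInt
    refine continuous_of_dominated (bound := fun _ => C) (fun t => ?_)
      (fun t => ae_of_all _ fun t' => hbound t t') (integrable_const C) (ae_of_all _ fun t' => ?_)
    · have : Continuous (innerFn W R F γ t) := by
        unfold innerFn RTFData.chi'conj
        exact (Complex.continuous_conj.comp hc').mul (hFc.comp (continuous_const.mul continuous_subtype_val))
      exact this.aestronglyMeasurable
    · unfold innerFn RTFData.chi'conj
      exact continuous_const.mul
        (hFc.comp ((continuous_subtype_val.inv.mul continuous_const).mul continuous_const))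
  have hmeas : AEStronglyMeasurable (fun t : torusT W => R.chi t * innerInt W R F γ t) (R.μT.restrict R.DT) :=
    (hc.mul hcontI).aestronglyMeasurable
  refine Integrable.mono' (integrable_const (C * R.μT'.real R.DT')) hmeas (ae_of_all _ fun t => ?_)
  rw [norm_mul, hu, one_mul]
  exact norm_setIntegral_le_of_norm_le_const hR.2.2.2.2.2 fun t' _ => hbound t t'

omit [BorelSpace (GA W)] in
/-- (A4) the orbit sum of the outer `L¹`-norms is summable (finitely many orbit points meet
`closure D_T · supp F · (closure D_{T′})⁻¹`). -/
theorem summable_integral_norm_chi_mul_innerInt_orbit (_hR : R.IsHaar) (_hc : Continuous R.chi)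
    (_hu : ∀ a, ‖R.chi a‖ = 1) (_hc' : Continuous R.chi') (_hu' : ∀ a, ‖R.chi' a‖ = 1)
    (compT : IsCompact (closure R.DT)) (compT' : IsCompact (closure R.DT'))
    (F : GA W → ℂ) (_hFc : Continuous F) (hFs : HasCompactSupport F) (γ₀ : rationalPoints W) :
    Summable (fun γ : Set.range (orbitMap W γ₀) =>
      ∫ t in R.DT, ‖R.chi t * innerInt W R F ((γ : rationalPoints W) : GA W) t‖ ∂(R.μT)) := by
  obtain ⟨s, hs⟩ := exists_finset_orbit W γ₀ (compT.image continuous_subtype_val)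
    (compT'.image continuous_subtype_val) F hFs
  refine summable_of_ne_finset_zero (s := s) fun γ hγ => ?_
  refine setIntegral_eq_zero_of_forall_eq_zero fun t ht => ?_
  have hin : innerInt W R F ((γ : rationalPoints W) : GA W) t = 0 :=
    innerInt_eq_zero_of_forall W R F _ t fun t' ht' =>
      hs γ hγ (t : GA W) ⟨t, subset_closure ht, rfl⟩ (t' : GA W) ⟨t', subset_closure ht', rfl⟩
  simp [hin]

omit [BorelSpace (GA W)] in
/-- (B0) the orbit sum of the folded orbital integrals is summable (same finite support). -/
theorem summable_orbitalc_orbit (_hR : R.IsHaar) (_hc : Continuous R.chi) (_hu : ∀ a, ‖R.chi a‖ = 1)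
    (_hc' : Continuous R.chi') (_hu' : ∀ a, ‖R.chi' a‖ = 1)
    (compT : IsCompact (closure R.DT)) (compT' : IsCompact (closure R.DT'))
    (F : GA W → ℂ) (_hFc : Continuous F) (hFs : HasCompactSupport F) (γ₀ : rationalPoints W) :
    Summable (fun γ : Set.range (orbitMap W γ₀) => R.orbitalc ((γ : rationalPoints W) : GA W) F) := by
  obtain ⟨s, hs⟩ := exists_finset_orbit W γ₀ (compT.image continuous_subtype_val)
    (compT'.image continuous_subtype_val) F hFs
  refine summable_of_ne_finset_zero (s := s) fun γ hγ => ?_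
  exact orbitalc_eq_zero_of_forall W R F _ fun t ht t' ht' =>
    hs γ hγ (t : GA W) ⟨t, subset_closure ht, rfl⟩ (t' : GA W) ⟨t', subset_closure ht', rfl⟩

omit [BorelSpace (GA W)] in
/-- (B4) for fixed rational `δ` the `T′(k)`-sum of outer `L¹`-norms is summable (finite support again). -/
theorem summable_integral_norm_chi_mul_innerInt_rational (_hR : R.IsHaar) (_hc : Continuous R.chi)
    (_hu : ∀ a, ‖R.chi a‖ = 1) (_hc' : Continuous R.chi') (_hu' : ∀ a, ‖R.chi' a‖ = 1)
    (compT : IsCompact (closure R.DT)) (compT' : IsCompact (closure R.DT'))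
    (F : GA W → ℂ) (_hFc : Continuous F) (hFs : HasCompactSupport F) (γ₀ : rationalPoints W)
    (δ : rationalOf W (torusT W)) :
    Summable (fun δ' : rationalOf W (torusT' W) =>
      ∫ t in R.DT, ‖R.chi t * innerInt W R F (((δ : torusT W) : GA W)⁻¹ * (γ₀ : GA W) * ((δ' : torusT' W) : GA W)) t‖
        ∂(R.μT)) := by
  obtain ⟨s, hs⟩ := exists_finset_rationalOf' W (((δ : torusT W) : GA W)⁻¹ * (γ₀ : GA W))
    (compT.image continuous_subtype_val) (compT'.image continuous_subtype_val) F hFs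
  refine summable_of_ne_finset_zero (s := s) fun δ' hδ' => ?_
  refine setIntegral_eq_zero_of_forall_eq_zero fun t ht => ?_
  have hin : innerInt W R F (((δ : torusT W) : GA W)⁻¹ * (γ₀ : GA W) * ((δ' : torusT' W) : GA W)) t = 0 :=
    innerInt_eq_zero_of_forall W R F _ t fun t' ht' =>
      hs δ' hδ' (t : GA W) ⟨t, subset_closure ht, rfl⟩ (t' : GA W) ⟨t', subset_closure ht', rfl⟩
  simp [hin]

end Integ

end Summit.Ventures.HodgeRepro.Tier4.Line4

end
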